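import Literature.AnabelianGeometry.SemiGraphs.UniversalCoveringOverDeck
import Literature.AnabelianGeometry.SemiGraphs.UniversalCoveringOverTransitive
import Literature.AnabelianGeometry.SemiGraphs.UniversalCoveringOverCountable
import HarnessLib

/-!
# `𝒢_{∞,S} → 𝒢_S` is Galois: descent of automorphisms to the base and the deck group ([SemiAnbd] §3 p. 38)

Mochizuki, *Semi-graphs of anabelioids*, Publ. RIMS **42** (2006), §3, proof of Prop. 3.6, author's
manuscript p. 38 [cite: MochizukiSemiAnbd2006, Prop 3.6 p.38]: for a connected finite étale Galois
covering `𝒢_i → 𝒢`, "`𝒢_{∞,i} → 𝒢_i` [is] the 'combinatorial universal covering' of `𝒢_i` … thus,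
`Gal(𝒢_{∞,i}/𝒢_i)` is a free discrete group. One verifies immediately that `𝒢_{∞,i} → 𝒢` is a Galois
tempered covering"; `π₁^temp(𝒢) := lim_i Gal(𝒢_{∞,i}/𝒢)` then acts on each `𝒢_i` through
`Gal(𝒢_{∞,i}/𝒢) → Gal(𝒢_i/𝒢)` (proof of Thm. 3.7 (iii), p. 41: the finite semi-graphs `𝔾_j` and the maps
`V_i → V_j`).

In the cell's rendering (`𝒢_{∞,S} = S.univCoverOver (Sum.inl V₀) h𝒢`, seat abc-iut-L3-t9, with its
projection `S.univCoverOverProj` to `S`), for `S` CONNECTED (`hconn`) with POINT-TRANSITIVE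
endomorphisms (`htrans`, e.g. a connected finite étale Galois covering), this file proves:

* `CovObj.univCoverOverProj_fV_surjective` / `_fE_surjective` — `𝒢_{∞,S} → 𝒢_S` is surjective on every
  fibre; hence morphisms out of `S` are determined by their composite with it
  (`CovObj.hom_ext_of_univCoverOverProj_comp`);
* `CovObj.descendBase σ` — every endomorphism `σ` of `𝒢_{∞,S}` DESCENDS to an endomorphism of `S`
  (`σ ≫ proj = proj ≫ descendBase σ`; existence by `htrans` and the rigidity
  `univCoverOver_hom_ext` of abc-iut-L3-t9, uniqueness by fibre-surjectivity), functorially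
  (`descendBase_id`, `descendBase_comp`); whence the homomorphism
  `CovObj.descendBaseAut : Aut(𝒢_{∞,S}) →* Aut(S)` ("`Gal(𝒢_{∞,i}/𝒢) → Gal(𝒢_i/𝒢)`");
* its kernel is the deck group: `descendBase σ = 𝟙 ↔ σ ≫ proj = proj`
  (`descendBase_eq_id_iff`), every endomorphism over `S` is a deck transformation `deckOver γ`,
  `γ ∈ π₁(𝔾_S, V₀)` (`exists_eq_deckOver_of_comp_proj`), and `descendBaseAut (deckOverAut γ) = 1`.

Seat abc-iut-L3-t6 (row «(B5b) LEVEL DESCENT»). Nothing here bears on [IUTchIII] Cor. 3.12.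
-/

namespace Literature.AnabelianGeometry.SemiGraphs

namespace ProfiniteSemiGraph

open CategoryTheory

universe u

variable {𝒢 : ProfiniteSemiGraph.{u}} (S : CovObj 𝒢) (h𝒢 : 𝒢.IsCountable) (V₀ : S.OVertex)

/-! ### Fibre-surjectivity of `𝒢_{∞,S} → 𝒢_S` -/

/-- In a connected covering, every vertex-orbit and edge-orbit are joined by a morphism of the
fundamental groupoid of `𝔾_S`. [cite: MochizukiSemiAnbd2006, Def 3.5(ii) p.37] -/
theorem CovObj.nonempty_hom_inl_inr (hconn : ∀ p q : S.Point, S.SameComponent p q)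
    (V : S.OVertex) (E : S.OEdge) :
    Nonempty (S.orbitGraph.basept (Sum.inl V) ⟶ S.orbitGraph.basept (Sum.inr E)) := by
  obtain ⟨x, hx⟩ := CovObj.OVertex.exists_rep S V
  obtain ⟨y, hy⟩ := CovObj.OEdge.exists_rep S E
  have h := S.nonempty_hom_of_sameComponent (hconn (Sum.inl ⟨_, x⟩) (Sum.inr ⟨_, y⟩))
  change Nonempty (S.orbitGraph.basept (Sum.inl (Quot.mk S.VRel ⟨_, x⟩)) ⟶
    S.orbitGraph.basept (Sum.inr (Quot.mk S.ERel ⟨_, y⟩))) at h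
  rw [hx, hy] at h
  exact h

/-- **`𝒢_{∞,S} → 𝒢_S` is surjective on every vertex fibre** (for `S` connected): the point `x ∈ S_v`
is the image of `([x], x, p)` for any path class `p` from the base orbit to the orbit of `x`.
[cite: MochizukiSemiAnbd2006, Prop 3.6 p.38] -/
theorem CovObj.univCoverOverProj_fV_surjective (hconn : ∀ p q : S.Point, S.SameComponent p q)
    (v : 𝒢.graph.Vertex) :
    Function.Surjective ((S.univCoverOverProj (Sum.inl V₀) h𝒢).fV v).hom.hom := by
  intro x
  obtain ⟨p⟩ := S.nonempty_hom_inl_inl hconn V₀ (Quot.mk _ ⟨v, x⟩)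
  exact ⟨⟨⟨Quot.mk _ ⟨v, x⟩, rfl⟩, ⟨⟨x, rfl⟩, p⟩⟩, rfl⟩

/-- `𝒢_{∞,S} → 𝒢_S` is surjective on every edge fibre (for `S` connected).
[cite: MochizukiSemiAnbd2006, Prop 3.6 p.38] -/
theorem CovObj.univCoverOverProj_fE_surjective (hconn : ∀ p q : S.Point, S.SameComponent p q)
    (e : 𝒢.graph.Edge) :
    Function.Surjective ((S.univCoverOverProj (Sum.inl V₀) h𝒢).fE e).hom.hom := by
  intro y
  obtain ⟨q⟩ := S.nonempty_hom_inl_inr hconn V₀ (Quot.mk _ ⟨e, y⟩)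
  exact ⟨⟨⟨Quot.mk _ ⟨e, y⟩, rfl⟩, ⟨⟨y, rfl⟩, q⟩⟩, rfl⟩

/-- Morphisms out of a connected `S` are determined by their composites with `𝒢_{∞,S} → 𝒢_S`.
[cite: MochizukiSemiAnbd2006, Prop 3.6 p.38] -/
theorem CovObj.hom_ext_of_univCoverOverProj_comp (hconn : ∀ p q : S.Point, S.SameComponent p q)
    {X : CovObj 𝒢} (τ τ' : S ⟶ X)
    (h : S.univCoverOverProj (Sum.inl V₀) h𝒢 ≫ τ = S.univCoverOverProj (Sum.inl V₀) h𝒢 ≫ τ') :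
    τ = τ' := by
  refine CovHom.ext (funext fun v => ?_) (funext fun e => ?_)
  · apply ObjectProperty.hom_ext
    apply Action.Hom.ext
    apply ConcreteCategory.hom_ext
    intro x
    obtain ⟨t, rfl⟩ := S.univCoverOverProj_fV_surjective h𝒢 V₀ hconn v x
    exact congrArg (fun ξ : S.univCoverOver (Sum.inl V₀) h𝒢 ⟶ X => (ξ.fV v).hom.hom t) h
  · apply ObjectProperty.hom_ext
    apply Action.Hom.ext
    apply ConcreteCategory.hom_ext
    intro y
    obtain ⟨t, rfl⟩ := S.univCoverOverProj_fE_surjective h𝒢 V₀ hconn e y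
    exact congrArg (fun ξ : S.univCoverOver (Sum.inl V₀) h𝒢 ⟶ X => (ξ.fE e).hom.hom t) h

/-! ### Descent of endomorphisms of `𝒢_{∞,S}` to `𝒢_S` -/

variable
  (htrans : ∀ (v : 𝒢.graph.Vertex) (x x' : (S.SV v).obj.V), ∃ σ : S ⟶ S, (σ.fV v).hom.hom x = x')

include htrans

/-- Existence of the descent: for an endomorphism `σ` of `𝒢_{∞,S}` there is an endomorphism `τ` of `S`
with `σ ≫ proj = proj ≫ τ` (the endomorphism of `S` moving `proj t₀` to `proj (σ t₀)`; the two
composites agree at `t₀`, hence everywhere by rigidity). [cite: MochizukiSemiAnbd2006, Prop 3.6 p.38] -/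
theorem CovObj.exists_descendBase
    (σ : S.univCoverOver (Sum.inl V₀) h𝒢 ⟶ S.univCoverOver (Sum.inl V₀) h𝒢) :
    ∃ τ : S ⟶ S, σ ≫ S.univCoverOverProj (Sum.inl V₀) h𝒢 = S.univCoverOverProj (Sum.inl V₀) h𝒢 ≫ τ := by
  obtain ⟨t₀⟩ := S.nonempty_fibV_base V₀
  obtain ⟨τ, hτ⟩ := htrans _ (((S.univCoverOverProj (Sum.inl V₀) h𝒢).fV _).hom.hom t₀)
    (((S.univCoverOverProj (Sum.inl V₀) h𝒢).fV _).hom.hom ((σ.fV _).hom.hom t₀))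
  exact ⟨τ, S.univCoverOver_hom_ext _ h𝒢 _ _ t₀ hτ.symm⟩

/-- **The descent `descendBase σ` of an endomorphism `σ` of `𝒢_{∞,S}` to an endomorphism of `S`.**
[cite: MochizukiSemiAnbd2006, Prop 3.6 p.38] -/
noncomputable def CovObj.descendBase
    (σ : S.univCoverOver (Sum.inl V₀) h𝒢 ⟶ S.univCoverOver (Sum.inl V₀) h𝒢) : S ⟶ S :=
  (S.exists_descendBase h𝒢 V₀ htrans σ).choose

/-- The defining square `σ ≫ proj = proj ≫ descendBase σ`. [cite: MochizukiSemiAnbd2006, Prop 3.6 p.38] -/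
theorem CovObj.comp_univCoverOverProj_eq
    (σ : S.univCoverOver (Sum.inl V₀) h𝒢 ⟶ S.univCoverOver (Sum.inl V₀) h𝒢) :
    σ ≫ S.univCoverOverProj (Sum.inl V₀) h𝒢 =
      S.univCoverOverProj (Sum.inl V₀) h𝒢 ≫ S.descendBase h𝒢 V₀ htrans σ :=
  (S.exists_descendBase h𝒢 V₀ htrans σ).choose_spec

variable (hconn : ∀ p q : S.Point, S.SameComponent p q)

include hconn

/-- Uniqueness of the descent (for `S` connected). [cite: MochizukiSemiAnbd2006, Prop 3.6 p.38] -/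
theorem CovObj.descendBase_unique
    (σ : S.univCoverOver (Sum.inl V₀) h𝒢 ⟶ S.univCoverOver (Sum.inl V₀) h𝒢) (τ : S ⟶ S)
    (h : σ ≫ S.univCoverOverProj (Sum.inl V₀) h𝒢 = S.univCoverOverProj (Sum.inl V₀) h𝒢 ≫ τ) :
    τ = S.descendBase h𝒢 V₀ htrans σ :=
  S.hom_ext_of_univCoverOverProj_comp h𝒢 V₀ hconn _ _
    (h.symm.trans (S.comp_univCoverOverProj_eq h𝒢 V₀ htrans σ))

/-- The identity descends to the identity. [cite: MochizukiSemiAnbd2006, Prop 3.6 p.38] -/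
theorem CovObj.descendBase_id : S.descendBase h𝒢 V₀ htrans (𝟙 _) = 𝟙 S :=
  (S.descendBase_unique h𝒢 V₀ htrans hconn (𝟙 _) (𝟙 S) (by
    rw [Category.id_comp, Category.comp_id])).symm

/-- Descent is compatible with composition. [cite: MochizukiSemiAnbd2006, Prop 3.6 p.38] -/
theorem CovObj.descendBase_comp
    (σ σ' : S.univCoverOver (Sum.inl V₀) h𝒢 ⟶ S.univCoverOver (Sum.inl V₀) h𝒢) :
    S.descendBase h𝒢 V₀ htrans (σ ≫ σ') =
      S.descendBase h𝒢 V₀ htrans σ ≫ S.descendBase h𝒢 V₀ htrans σ' :=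
  (S.descendBase_unique h𝒢 V₀ htrans hconn (σ ≫ σ') _ (by
    rw [Category.assoc, S.comp_univCoverOverProj_eq h𝒢 V₀ htrans σ', ← Category.assoc,
      S.comp_univCoverOverProj_eq h𝒢 V₀ htrans σ, Category.assoc])).symm

/-- The descent of an automorphism of `𝒢_{∞,S}`, an automorphism of `S`.
[cite: MochizukiSemiAnbd2006, Prop 3.6 p.38] -/
noncomputable def CovObj.descendBaseIso (σ : Aut (S.univCoverOver (Sum.inl V₀) h𝒢)) : Aut S where
  hom := S.descendBase h𝒢 V₀ htrans σ.hom
  inv := S.descendBase h𝒢 V₀ htrans σ.inv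
  hom_inv_id := by
    rw [← S.descendBase_comp h𝒢 V₀ htrans hconn, σ.hom_inv_id, S.descendBase_id h𝒢 V₀ htrans hconn]
  inv_hom_id := by
    rw [← S.descendBase_comp h𝒢 V₀ htrans hconn, σ.inv_hom_id, S.descendBase_id h𝒢 V₀ htrans hconn]

/-- **The descent homomorphism `Aut(𝒢_{∞,S}) →* Aut(𝒢_S)`** ("`Gal(𝒢_{∞,i}/𝒢) → Gal(𝒢_i/𝒢)`": the
action of `π₁^temp(𝒢) = lim Aut(𝒢_{∞,i})` on the finite levels `𝒢_i`, p. 41), for `S` connected with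
point-transitive endomorphisms. [cite: MochizukiSemiAnbd2006, Prop 3.6 p.38] -/
noncomputable def CovObj.descendBaseAut : Aut (S.univCoverOver (Sum.inl V₀) h𝒢) →* Aut S where
  toFun := S.descendBaseIso h𝒢 V₀ htrans hconn
  map_one' := Iso.ext (S.descendBase_id h𝒢 V₀ htrans hconn)
  map_mul' σ τ := Iso.ext (by
    change S.descendBase h𝒢 V₀ htrans (τ.hom ≫ σ.hom) =
      S.descendBase h𝒢 V₀ htrans τ.hom ≫ S.descendBase h𝒢 V₀ htrans σ.hom
    exact S.descendBase_comp h𝒢 V₀ htrans hconn τ.hom σ.hom)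

/-- `descendBaseAut` on `hom`s. [cite: MochizukiSemiAnbd2006, Prop 3.6 p.38] -/
@[simp] theorem CovObj.descendBaseAut_hom (σ : Aut (S.univCoverOver (Sum.inl V₀) h𝒢)) :
    (S.descendBaseAut h𝒢 V₀ htrans hconn σ).hom = S.descendBase h𝒢 V₀ htrans σ.hom := rfl

/-- The defining square for automorphisms: `σ ≫ proj = proj ≫ (descendBaseAut σ)`.
[cite: MochizukiSemiAnbd2006, Prop 3.6 p.38] -/
theorem CovObj.aut_hom_comp_univCoverOverProj (σ : Aut (S.univCoverOver (Sum.inl V₀) h𝒢)) :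
    σ.hom ≫ S.univCoverOverProj (Sum.inl V₀) h𝒢 =
      S.univCoverOverProj (Sum.inl V₀) h𝒢 ≫ (S.descendBaseAut h𝒢 V₀ htrans hconn σ).hom :=
  S.comp_univCoverOverProj_eq h𝒢 V₀ htrans σ.hom

/-! ### The kernel of descent is the deck group -/

/-- `σ` descends to the identity iff `σ` lies over `S`. [cite: MochizukiSemiAnbd2006, Prop 3.6 p.38] -/
theorem CovObj.descendBase_eq_id_iff
    (σ : S.univCoverOver (Sum.inl V₀) h𝒢 ⟶ S.univCoverOver (Sum.inl V₀) h𝒢) :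
    S.descendBase h𝒢 V₀ htrans σ = 𝟙 S ↔
      σ ≫ S.univCoverOverProj (Sum.inl V₀) h𝒢 = S.univCoverOverProj (Sum.inl V₀) h𝒢 := by
  constructor
  · intro h
    have h' := S.comp_univCoverOverProj_eq h𝒢 V₀ htrans σ
    rw [h, Category.comp_id] at h'
    exact h'
  · intro h
    exact (S.descendBase_unique h𝒢 V₀ htrans hconn σ (𝟙 S) (h.trans (Category.comp_id _).symm)).symm

/-- Deck transformations descend to the identity. [cite: MochizukiSemiAnbd2006, Prop 3.6 p.38] -/
theorem CovObj.descendBase_deckOver (γ : S.orbitGraph.FundamentalGroup (Sum.inl V₀)) :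
    S.descendBase h𝒢 V₀ htrans (S.deckOver (Sum.inl V₀) h𝒢 γ) = 𝟙 S :=
  (S.descendBase_eq_id_iff h𝒢 V₀ htrans hconn _).mpr (S.deckOver_comp_proj (Sum.inl V₀) h𝒢 γ)

/-- Deck transformations lie in the kernel of `descendBaseAut`. [cite: MochizukiSemiAnbd2006, Prop 3.6 p.38] -/
theorem CovObj.descendBaseAut_deckOverAut (γ : S.orbitGraph.FundamentalGroup (Sum.inl V₀)) :
    S.descendBaseAut h𝒢 V₀ htrans hconn (S.deckOverAut (Sum.inl V₀) h𝒢 γ) = 1 :=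
  Iso.ext (S.descendBase_deckOver h𝒢 V₀ htrans hconn γ)

omit htrans hconn in
/-- Two points of a vertex fibre of `𝒢_{∞,S}` with the same orbit component and the same point of
`S_v` differ by a deck transformation. [cite: MochizukiSemiAnbd2006, Prop 3.6 p.38] -/
theorem CovObj.exists_deckOver_apply_eq {c : S.orbitGraph.CatCarrier} {v : 𝒢.graph.Vertex}
    (t t' : S.FibV c v) (h1 : t'.1 = t.1) (h2 : t'.2.1.1 = t.2.1.1) :
    ∃ γ : S.orbitGraph.FundamentalGroup c, ((S.deckOver c h𝒢 γ).fV v).hom.hom t = t' := by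
  obtain ⟨⟨V, hV⟩, ⟨x, hx⟩, p⟩ := t
  obtain ⟨⟨V', hV'⟩, ⟨x', hx'⟩, p'⟩ := t'
  cases h1
  cases h2
  refine ⟨p ≫ inv p', CovObj.FibV.ext S c rfl rfl (heq_of_eq ?_)⟩
  change inv (p ≫ inv p') ≫ p = p'
  rw [IsIso.inv_comp, IsIso.inv_inv, Category.assoc, IsIso.inv_hom_id, Category.comp_id]

omit htrans hconn in
/-- **Endomorphisms of `𝒢_{∞,S}` over `𝒢_S` are deck transformations** (`Gal(𝒢_{∞,i}/𝒢_i) ≅ π₁(𝔾_i)`,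
p. 38: the free deck action exhausts the automorphisms over `S`, by rigidity).
[cite: MochizukiSemiAnbd2006, Prop 3.6 p.38] -/
theorem CovObj.exists_eq_deckOver_of_comp_proj
    (σ : S.univCoverOver (Sum.inl V₀) h𝒢 ⟶ S.univCoverOver (Sum.inl V₀) h𝒢)
    (h : σ ≫ S.univCoverOverProj (Sum.inl V₀) h𝒢 = S.univCoverOverProj (Sum.inl V₀) h𝒢) :
    ∃ γ : S.orbitGraph.FundamentalGroup (Sum.inl V₀), σ = S.deckOver (Sum.inl V₀) h𝒢 γ := by
  obtain ⟨t₀⟩ := S.nonempty_fibV_base V₀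
  -- the image of `t₀` lies over the same point of `S`
  have hx : ((σ.fV _).hom.hom t₀).2.1.1 = t₀.2.1.1 :=
    congrArg (fun ξ : S.univCoverOver (Sum.inl V₀) h𝒢 ⟶ S => (ξ.fV _).hom.hom t₀) h
  -- hence over the same vertex of `𝔾_S`
  have hV : ((σ.fV _).hom.hom t₀).1 = t₀.1 :=
    Subtype.ext ((((σ.fV _).hom.hom t₀).2.1.2).symm.trans
      ((congrArg (fun x => (Quot.mk S.VRel ⟨_, x⟩ : S.OVertex)) hx).trans t₀.2.1.2))
  obtain ⟨γ, hγ⟩ := S.exists_deckOver_apply_eq h𝒢 t₀ _ hV hx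
  exact ⟨γ, S.univCoverOver_hom_ext _ h𝒢 _ _ t₀ hγ.symm⟩

/-- **The kernel of `descendBaseAut` is the deck group**: an automorphism of `𝒢_{∞,S}` descends to the
identity of `S` iff it is a deck transformation `deckOverAut γ`, `γ ∈ π₁(𝔾_S, V₀)`.
[cite: MochizukiSemiAnbd2006, Prop 3.6 p.38] -/
theorem CovObj.descendBaseAut_eq_one_iff (σ : Aut (S.univCoverOver (Sum.inl V₀) h𝒢)) :
    S.descendBaseAut h𝒢 V₀ htrans hconn σ = 1 ↔
      ∃ γ : S.orbitGraph.FundamentalGroup (Sum.inl V₀), σ = S.deckOverAut (Sum.inl V₀) h𝒢 γ := by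
  constructor
  · intro h
    have h' : S.descendBase h𝒢 V₀ htrans σ.hom = 𝟙 S := congrArg Iso.hom h
    obtain ⟨γ, hγ⟩ := S.exists_eq_deckOver_of_comp_proj h𝒢 V₀ σ.hom
      ((S.descendBase_eq_id_iff h𝒢 V₀ htrans hconn σ.hom).mp h')
    exact ⟨γ, Iso.ext hγ⟩
  · rintro ⟨γ, rfl⟩
    exact S.descendBaseAut_deckOverAut h𝒢 V₀ htrans hconn γ

/-! ### Descent is surjective: `Aut(𝒢_{∞,S}) → Aut(𝒢_S)` is onto -/

/-- A lift of an endomorphism `τ` of `S` to an endomorphism of `𝒢_{∞,S}`: the map `𝒢_{∞,S} → 𝒢_{∞,S}`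
induced by `τ` (landing in `𝒢_{∞,S}` based at `τ̄ V₀`) followed by the base change along a path class
`τ̄ V₀ ⟶ V₀` of `𝔾_S` (which exists, `S` being connected). [cite: MochizukiSemiAnbd2006, Prop 3.6 p.38] -/
noncomputable def CovObj.liftBase (τ : S ⟶ S) :
    S.univCoverOver (Sum.inl V₀) h𝒢 ⟶ S.univCoverOver (Sum.inl V₀) h𝒢 :=
  CovObj.univCoverOverMap τ (Sum.inl V₀) h𝒢 ≫
    S.baseChangeHom (Classical.choice (S.nonempty_hom_inl_inl hconn (CovObj.OVertex.map τ V₀) V₀)) h𝒢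

omit htrans in
/-- The lift lies over `τ`: `liftBase τ ≫ proj = proj ≫ τ`. [cite: MochizukiSemiAnbd2006, Prop 3.6 p.38] -/
theorem CovObj.liftBase_comp_univCoverOverProj (τ : S ⟶ S) :
    S.liftBase h𝒢 V₀ hconn τ ≫ S.univCoverOverProj (Sum.inl V₀) h𝒢 =
      S.univCoverOverProj (Sum.inl V₀) h𝒢 ≫ τ := by
  change (CovObj.univCoverOverMap τ (Sum.inl V₀) h𝒢 ≫ S.baseChangeHom _ h𝒢) ≫ _ = _
  rw [Category.assoc]
  exact (congrArg (CovObj.univCoverOverMap τ (Sum.inl V₀) h𝒢 ≫ ·)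
    (S.baseChangeHom_comp_proj _ h𝒢)).trans (CovObj.univCoverOverMap_comp_proj τ (Sum.inl V₀) h𝒢)

/-- The lift descends back to `τ`. [cite: MochizukiSemiAnbd2006, Prop 3.6 p.38] -/
theorem CovObj.descendBase_liftBase (τ : S ⟶ S) :
    S.descendBase h𝒢 V₀ htrans (S.liftBase h𝒢 V₀ hconn τ) = τ :=
  (S.descendBase_unique h𝒢 V₀ htrans hconn _ τ (S.liftBase_comp_univCoverOverProj h𝒢 V₀ hconn τ)).symm

omit htrans in
/-- Every automorphism `τ` of `S` lifts to an AUTOMORPHISM of `𝒢_{∞,S}` over it: the lifts of `τ` and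
`τ⁻¹` compose, in either order, to endomorphisms over `S`, i.e. to deck transformations, which are
invertible. [cite: MochizukiSemiAnbd2006, Prop 3.6 p.38] -/
theorem CovObj.exists_aut_hom_comp_univCoverOverProj (τ : Aut S) :
    ∃ σ : Aut (S.univCoverOver (Sum.inl V₀) h𝒢),
      σ.hom ≫ S.univCoverOverProj (Sum.inl V₀) h𝒢 = S.univCoverOverProj (Sum.inl V₀) h𝒢 ≫ τ.hom := by
  have h₁ := S.liftBase_comp_univCoverOverProj h𝒢 V₀ hconn τ.hom
  have h₂ := S.liftBase_comp_univCoverOverProj h𝒢 V₀ hconn τ.inv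
  have h12 : (S.liftBase h𝒢 V₀ hconn τ.hom ≫ S.liftBase h𝒢 V₀ hconn τ.inv) ≫
      S.univCoverOverProj (Sum.inl V₀) h𝒢 = S.univCoverOverProj (Sum.inl V₀) h𝒢 := by
    rw [Category.assoc, h₂, ← Category.assoc, h₁, Category.assoc, τ.hom_inv_id, Category.comp_id]
  have h21 : (S.liftBase h𝒢 V₀ hconn τ.inv ≫ S.liftBase h𝒢 V₀ hconn τ.hom) ≫
      S.univCoverOverProj (Sum.inl V₀) h𝒢 = S.univCoverOverProj (Sum.inl V₀) h𝒢 := by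
    rw [Category.assoc, h₁, ← Category.assoc, h₂, Category.assoc, τ.inv_hom_id, Category.comp_id]
  obtain ⟨γ, hγ⟩ := S.exists_eq_deckOver_of_comp_proj h𝒢 V₀ _ h12
  obtain ⟨δ, hδ⟩ := S.exists_eq_deckOver_of_comp_proj h𝒢 V₀ _ h21
  -- a right inverse and a left inverse of the lift of `τ`
  have hr : S.liftBase h𝒢 V₀ hconn τ.hom ≫ (S.liftBase h𝒢 V₀ hconn τ.inv ≫
      S.deckOver (Sum.inl V₀) h𝒢 γ⁻¹) = 𝟙 _ := by
    rw [← Category.assoc, hγ, ← CovObj.deckOver_mul, mul_inv_cancel, CovObj.deckOver_one]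
  have hl : (S.deckOver (Sum.inl V₀) h𝒢 δ⁻¹ ≫ S.liftBase h𝒢 V₀ hconn τ.inv) ≫
      S.liftBase h𝒢 V₀ hconn τ.hom = 𝟙 _ := by
    rw [Category.assoc, hδ, ← CovObj.deckOver_mul, inv_mul_cancel, CovObj.deckOver_one]
  -- hence they coincide
  have hlr : S.deckOver (Sum.inl V₀) h𝒢 δ⁻¹ ≫ S.liftBase h𝒢 V₀ hconn τ.inv =
      S.liftBase h𝒢 V₀ hconn τ.inv ≫ S.deckOver (Sum.inl V₀) h𝒢 γ⁻¹ := by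
    calc S.deckOver (Sum.inl V₀) h𝒢 δ⁻¹ ≫ S.liftBase h𝒢 V₀ hconn τ.inv
        = (S.deckOver (Sum.inl V₀) h𝒢 δ⁻¹ ≫ S.liftBase h𝒢 V₀ hconn τ.inv) ≫
            (S.liftBase h𝒢 V₀ hconn τ.hom ≫ (S.liftBase h𝒢 V₀ hconn τ.inv ≫
              S.deckOver (Sum.inl V₀) h𝒢 γ⁻¹)) := by rw [hr, Category.comp_id]
      _ = ((S.deckOver (Sum.inl V₀) h𝒢 δ⁻¹ ≫ S.liftBase h𝒢 V₀ hconn τ.inv) ≫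
            S.liftBase h𝒢 V₀ hconn τ.hom) ≫ (S.liftBase h𝒢 V₀ hconn τ.inv ≫
              S.deckOver (Sum.inl V₀) h𝒢 γ⁻¹) := by simp only [Category.assoc]
      _ = S.liftBase h𝒢 V₀ hconn τ.inv ≫ S.deckOver (Sum.inl V₀) h𝒢 γ⁻¹ := by
          rw [hl, Category.id_comp]
  refine ⟨⟨S.liftBase h𝒢 V₀ hconn τ.hom,
    S.liftBase h𝒢 V₀ hconn τ.inv ≫ S.deckOver (Sum.inl V₀) h𝒢 γ⁻¹, hr, ?_⟩, h₁⟩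
  rw [← hlr]
  exact hl

/-- **Descent is surjective: every automorphism of `𝒢_S` is the descent of an automorphism of
`𝒢_{∞,S}`** — with `descendBaseAut_eq_one_iff`: `1 → π₁(𝔾_S) → Aut(𝒢_{∞,S}) → Aut(𝒢_S) → 1` is
exact ("`𝒢_{∞,i} → 𝒢` is a Galois tempered covering", p. 38), for `S` connected with point-transitive
endomorphisms. [cite: MochizukiSemiAnbd2006, Prop 3.6 p.38] -/
theorem CovObj.descendBaseAut_surjective :
    Function.Surjective (S.descendBaseAut h𝒢 V₀ htrans hconn) := by
  intro τ
  obtain ⟨σ, hσ⟩ := S.exists_aut_hom_comp_univCoverOverProj h𝒢 V₀ hconn τ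
  exact ⟨σ, Iso.ext (S.descendBase_unique h𝒢 V₀ htrans hconn σ.hom τ.hom hσ).symm⟩

end ProfiniteSemiGraph

end Literature.AnabelianGeometry.SemiGraphs
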